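import Literature.MathematicalPhysics.QuantumFieldTheory.Balaban1983to89.Node00.StepWeightsOfRecord
import Literature.MathematicalPhysics.QuantumFieldTheory.Balaban1983to89.Node00.Record12Measurability

/-!
# NODE 00 — DEFINER ₇b/₉ (T-side), FILE 19: «THRESHOLDS AS A LETTER» — the T-side objects of record RE-TYPED THRESHOLD-PARAMETRIC,
# with the record as the `rfl` instance: the front factor `χ_k(Ω_k)` (2.17)∕(2.18) at a threshold letter `ε`, the (3.2) factor and label
# weight at `ε`, the (3.3) label weight at `δ′`, the label ∕ step weights, the T-step (3.1), the represented tower and the assembled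
# density (2.18) along threshold letters `Θ, Δ : run → couplings → level → ℝ`; every law of FILES 1∕2, of the `wOfRecord` hand and of the
# (H-U) measurability layer re-proved letter-generically (the proofs of record never read the value of the threshold)

Seat `pub-ymgap-node00-def-T` (DEFINER ₇b/₉ «T-STEP + REPRESENTED TOWER», gen 14).  [III] = [Balaban1988Convergent], [IV] = [Balaban1989LargeFieldI],
[I] = [Balaban1987RG1].  TRIGGER (by-name located ask): dag-n21-d g5 LOCATED-THRESHOLD-PINS (cell bus 2026-08-27T04:28Z) — *«the selection road
(18b∕20∕20c∕21b) needs NODE O's term object THRESHOLD-PARAMETRIC over the admissible box. In the typed T-side of NODE 00 the thresholds are PINNED at exactly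
THREE decls: `chiSeqOfRecord` ((2.17) at `epsOfRecord ν g k`), `aWeight` ((3.2) at `epsOfRecord ν g (k + 1)`), `bWeight` ((3.3) at `2 * deltaOfRecord ν g k A₁`);
EVERYTHING downstream is generic in the weight datum … ⇒ a DEFINITION-LANE generalisation «thresholds as a letter» with the record as the instance (`rfl`
bridges) makes the whole T-side tower threshold-parametric AT NO analytic cost»*; dag-n21-e g6 LANDED-16 waits on the same twin for the front-factor half of
its tower-level mixture.

WHAT THIS FILE IS.  APPEND-ONLY twins under NEW names (no body of an accepted declaration is touched; gate D-0009):
* §0 folklore measurability ∕ monotonicity of the small-field factor `chiSmall` (private, restated so as not to import the T4 gauge-fixing chain).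
* §1 `chiSeqOfRecordAt … k ε s` = def-R's `chiSeqOfRecord` with `ε_k` a LETTER: `Π_{□⊂Ω_k} χ({sup_{p⊂□^∼}|U_{k,□}(∂p) − 1| < ε η_k²})` — bridge
  `chiSeqOfRecord_eq_at` (`rfl` at `ε := epsOfRecord ν g k`); `0 ≤ χ ≤ 1`, `|χ| ≤ 1`, `χ_0 ≡ 1`, MONOTONE in `ε`.
* §2 `chiFactorAt … ε c` = the ONE (3.2) factor of the χ_{k+1}-cube `□′` at threshold `ε` (bridge `chiFactor_eq_at`); idempotent, in `[0,1]`, monotone in `ε`;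
  `chiSeqOfRecordAt_succ_σOfRecord`: `χ_{k+1}(Ω_{k+1}(t))` at `ε` is the product of the (3.2) factors at `ε` over the χ_{k+1}-cubes inside `Ω_{k+1}(t)`;
  r11's `chiNext` on the pinned `sect3DataOfRecord` at ANY `ε` is that product (`rfl`).
* §3 the label weights at letters: `aWeightAt … ε` ((3.2) at `ε`), `bWeightAt … δ′` ((3.3) at `δ′` in place of `2δ_k`), `ωOfRecordAt … ε δ′ ζ = a·b·ζ`; bridges
  `aWeight_eq_at` ∕ `bWeight_eq_at` ∕ `ωOfRecord_eq_at` (`rfl`); the laws of the `wOfRecord` hand VERBATIM at letters: `Σ_P a = 1` (r11's `eq32` at `ε`),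
  `Σ_Q b = 1` (`eq33` at `δ′`), `a, b ≥ 0`, FRONT-FACTOR ABSORPTION `χ_{k+1}(σ s t)|_ε · a|_ε = a|_ε` (ONE letter `ε` for (2.17)_{k+1} and (3.2) — as in
  print, where both read `ε_{k+1}`), (O2) `Σ_t χ_{k+1}(σ s t)|_ε · ω|_{ε,δ′} = 1` pointwise, (O3) `Σ_t |ω| ≤ 1`.
* §4 THRESHOLD LETTERS `ThresholdLetter := run → couplings → level → ℝ`, the letters OF RECORD `epsLetterOfRecord ν = (p, g, j) ↦ ε_j = epsOfRecord ν g j`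
  ((2.17)∕(3.2): `g_j·A₀p₀(g_j)`-profile of [I] (1.16)) and `twoDeltaLetterOfRecord ν A₁ = (p, g, j) ↦ 2δ_j` ((3.4)); the STEP WEIGHTS AT LETTERS
  `wOfRecordAt Θ Δ ζ := stepWeightsOfResum … (ωOfRecordAt … (Θ p g (k+1)) (Δ p g k) ζ)` with bridge `wOfRecord_eq_at : wOfRecord A₁ ζ = wOfRecordAt ε^rec (2δ)^rec ζ`
  (`rfl`) and the three provisos at letters: `isStepUnity_wOfRecordAt` (against the front factors `χ_k|_{Θ_k}`, `χ_{k+1}|_{Θ_{k+1}}`), `abs_wOfRecordAt_le_one`,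
  `measurable_wOfRecordAt` ((O4)-shape hypothesis).
* §5 the T-STEP AT LETTERS `tstepOfRecordAt Θ w` ((3.1) with the old front factor `χ_k|_{Θ_k}`; bridge `tstepOfRecord_eq_at`), its `IsRT` face
  `isRT_tstepOfRecordAt` and integrability `integrable_tstepOfRecordAt` (copies of FILE 1 ∕ K0′-G3 (P1)); the REPRESENTED TOWER AT LETTERS `texpAOfRecordAt Θ E w R`
  (R-step a slot-operation parameter, as in FILE 1), `texpATOfRecordAt`, the post∕pre-𝐑 slot families `slotsOfRecordAt` ∕ `slotsTOfRecordAt`, the (2.18) datum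
  `repr218OfRecordAt`, the assembled density `densityOfReprAt Θ` = `Σ_s χ_k(s)|_{Θ_k}·slot(s)` and `rhoOfRecordAt` ∕ `trhoOfRecordAt`, each with its `rfl`
  (or by-cases `rfl`) bridge to the record and `eval_zero` (`densityOfReprAt_texpAOfRecordAt_zero`: level 0 is `ρ₀`, `χ_0 ≡ 1` at any letter).
* §6 UNDER (H-U) (K0′-G3's displayed `LocalBgMeasurable`) and (H-ζ): `χ_k|_ε`, the (3.2) factor at `ε`, `a|_ε`, `b|_{δ′}` (jointly), `ω|_{ε,δ′}`, `w|_{Θ,Δ}` are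
  measurable — the (P2)∕(P3) rows at letters, same proofs.

WHY NODE 00 (Literature) and not a Summits-side twin: the three pinned declarations are definition-lane objects of this lineage's cut (`aWeight`, `bWeight`,
`ωOfRecord`, `wOfRecord`, `tstepOfRecord`, `texpAOfRecord`) and def-R's `chiSeqOfRecord`; a Literature home is importable by BOTH the Node00 records and the
Summits-side roads (n19-d's `slotMeasure (w : StepWeightsOfRecord …)` ∕ `classMeasureOfSlots` are generic in `w` and read `wOfRecordAt Θ Δ ζ` by name; their
`withDensity (χ_k of record)` front factor reads `chiSeqOfRecordAt … (Θ p g k)`).  The ℝ-side thresholds (def-R's `rstepSlotOfRecord`, [IV] (0.3)) are NOT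
re-lettered here: the R-step stays the slot-operation PARAMETER `R` of `texpAOfRecordAt`, exactly as in FILE 1.

HONEST SCOPE.  Definitions of record re-typed with one more bound variable + kernel bookkeeping (`rfl` bridges; `Finset.prod_add` via r11's `eq32`∕`eq33`;
`Finset.sum_fiberwise` via FILE 2; `Finset.prod_le_prod`).  Nothing of Bałaban's is asserted: no estimate, (3.6)–(3.9) ∕ (3.12)–(3.19) not used, Theorem 2 not
asserted, no positivity of `ζ`, no admissible box of thresholds singled out (the selection is the consumers').  Route counts UNMOVED; nothing continuum ∕ ℝ⁴ ∕
OS ∕ mass-gap ∕ Clay.  No `sorry`, no `axiom`, no `opaque`, no `instance`, no `notation`.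
-/

noncomputable section

open MeasureTheory
open scoped BigOperators

namespace Literature.MathematicalPhysics.QuantumFieldTheory.Balaban1983to89.Node00

open T4Continuum B14.Eq218Concrete T4AveragingDisintegration T4FiniteEpsInhabited
open B15DeterminingSets B14.Eq213DetSet B14.Eq216Concrete B14.Eq213MaximalDomains B15Eq112TorusCover B14DomainGeom
open B14.Sect3Decomp

/-! ## §0  Folklore: the small-field factor is measurable and monotone in its threshold -/

section Folklore

variable {P : Params} {j : ℕ} {G : Type*}

/-- The small-field event `{U | |U(∂p) − 1| < δ, p ∈ S}` is a measurable set of configurations (the tree's `T4AxialGaugeFixing.measurableSet_plaqSmallOn`,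
restated so as not to import that chain). [folklore] -/
private theorem measurableSet_plaqSmallOn_at [MeasurableSpace G] [GaugeGroup G] [RegularGaugeGroup G] (S : Set (Plaq P j)) (δ : ℝ) :
    MeasurableSet {U : GaugeField P j G | PlaqSmallOn S δ U} := by
  have h : {U : GaugeField P j G | PlaqSmallOn S δ U} = ⋂ p : {p : Plaq P j // p ∈ S}, {U | dist1 (GaugeField.plaqHol U p.1) < δ} := by
    ext U; simp only [PlaqSmallOn, Set.mem_setOf_eq, Set.mem_iInter, Subtype.forall]
  rw [h]
  exact MeasurableSet.iInter fun p =>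
    measurableSet_lt (RegularGaugeGroup.measurable_dist1.comp (Missing.measurable_plaqHol p.1)) measurable_const

/-- The small-field factor `χ({…}) = chiSmall S δ` is measurable. [folklore] -/
private theorem measurable_chiSmall_at [MeasurableSpace G] [GaugeGroup G] [RegularGaugeGroup G] (S : Set (Plaq P j)) (δ : ℝ) :
    Measurable (chiSmall S δ : GaugeField P j G → ℝ) := by
  unfold chiSmall
  exact Measurable.ite (measurableSet_plaqSmallOn_at S δ) measurable_const measurable_const

/-- The small-field factor is monotone in its threshold: `δ ≤ δ′ ⇒ χ({… < δ}) ≤ χ({… < δ′})`. [folklore] -/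
private theorem chiSmall_mono_letter [GaugeGroup G] (S : Set (Plaq P j)) {δ δ' : ℝ} (h : δ ≤ δ') (U : GaugeField P j G) :
    chiSmall S δ U ≤ chiSmall S δ' U := by
  unfold chiSmall
  by_cases h1 : PlaqSmallOn S δ U
  · have h2 : PlaqSmallOn S δ' U := fun p hp => lt_of_lt_of_le (h1 p hp) h
    rw [if_pos h1, if_pos h2]
  · rw [if_neg h1]; split_ifs <;> norm_num

end Folklore

/-! ## §1  The front factor `χ_k(Ω_k)` of record AT A THRESHOLD LETTER `ε` -/

section FrontFactor

variable (F : T4Family) (N : ℕ) [NeZero N] (ν : Stage7Numerics) (M : ℕ) (g : ℕ → ℝ) (K k : ℕ)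

/-- **`χ_k(Ω_k)` OF RECORD AT THRESHOLD `ε`**: def-R's `chiSeqOfRecord` — r11's `chi218` with the [15] map of record, `M₁`, the `LM₂R_k`-cube family with its
`□^∼`-plaquettes and `□^{∼4}` enlargements — with the (2.17) threshold `ε_k` a LETTER `ε` (`Π_{□⊂Ω_k} χ({sup_{p⊂□^∼}|U_{k,□}(V_k,∂p) − 1| < ε η_k²})`; the record
is the instance `ε := epsOfRecord ν g k` (`chiSeqOfRecord_eq_at`). [cite: Balaban1988Convergent, (2.17)–(2.18) p.257] -/
def chiSeqOfRecordAt (ε : ℝ) (s : SeqOfRecord F ν M g K k) : GaugeField (F.P K) k (SU N) → ℝ :=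
  chi218 (ι := ↥(cubeIndices (F.P K) (cubeSide (F.P K).L ν.M₂ (RkOfRecord (F.P K).L ν.r (g k)) k)))
    (bgOfRecord (avOfRecord F N K) {U | PlaqSmall (ν.εreg * (F.P K).eta k ^ 2) U}) ν.M₁
    (fun a => cubeEnl (F.P K) (cubeSide (F.P K).L ν.M₂ (RkOfRecord (F.P K).L ν.r (g k)) k) a 0)
    (fun a => plaqInside (cubeEnl (F.P K) (cubeSide (F.P K).L ν.M₂ (RkOfRecord (F.P K).L ν.r (g k)) k) a 1))
    (fun a => cubeEnl (F.P K) (cubeSide (F.P K).L ν.M₂ (RkOfRecord (F.P K).L ν.r (g k)) k) a 4)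
    ε k s

/-- **BRIDGE**: `χ_k(Ω_k)` of record IS the letter version at `ε_k` of record (definitional). [cite: Balaban1988Convergent, (2.17)–(2.18) p.257 (bookkeeping)] -/
theorem chiSeqOfRecord_eq_at : chiSeqOfRecord F N ν M g K k = chiSeqOfRecordAt F N ν M g K k (epsOfRecord ν g k) := rfl

/-- `0 ≤ χ_k(Ω_k)|_ε` (a product of 0∕1 characteristic functions). [cite: Balaban1988Convergent, (2.17)–(2.18) p.257 (bookkeeping)] -/
theorem chiSeqOfRecordAt_nonneg (ε : ℝ) (s : SeqOfRecord F ν M g K k) (V : GaugeField (F.P K) k (SU N)) :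
    0 ≤ chiSeqOfRecordAt F N ν M g K k ε s V :=
  chi218_nonneg _ _ _ _ _ _ _ _ _

/-- `χ_k(Ω_k)|_ε ≤ 1`. [cite: Balaban1988Convergent, (2.17)–(2.18) p.257 (bookkeeping)] -/
theorem chiSeqOfRecordAt_le_one (ε : ℝ) (s : SeqOfRecord F ν M g K k) (V : GaugeField (F.P K) k (SU N)) :
    chiSeqOfRecordAt F N ν M g K k ε s V ≤ 1 :=
  chi218_le_one _ _ _ _ _ _ _ _ _

/-- `|χ_k(Ω_k)|_ε| ≤ 1`. [cite: Balaban1988Convergent, (2.17)–(2.18) p.257 (bookkeeping)] -/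
theorem abs_chiSeqOfRecordAt_le_one (ε : ℝ) (s : SeqOfRecord F ν M g K k) (V : GaugeField (F.P K) k (SU N)) :
    |chiSeqOfRecordAt F N ν M g K k ε s V| ≤ 1 :=
  abs_le.2 ⟨le_trans (by norm_num) (chiSeqOfRecordAt_nonneg F N ν M g K k ε s V), chiSeqOfRecordAt_le_one F N ν M g K k ε s V⟩

/-- **MONOTONICITY IN THE LETTER**: `ε ≤ ε′ ⇒ χ_k(Ω_k)|_ε ≤ χ_k(Ω_k)|_{ε′}` pointwise (each factor's small-field event grows with the threshold, `η_k² ≥ 0`).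
[cite: Balaban1988Convergent, (2.17) p.257 (bookkeeping)] -/
theorem chiSeqOfRecordAt_mono {ε ε' : ℝ} (h : ε ≤ ε') (s : SeqOfRecord F ν M g K k) (V : GaugeField (F.P K) k (SU N)) :
    chiSeqOfRecordAt F N ν M g K k ε s V ≤ chiSeqOfRecordAt F N ν M g K k ε' s V := by
  rw [chiSeqOfRecordAt, chiSeqOfRecordAt, chi218_apply, chi218_apply]
  exact Finset.prod_le_prod (fun c _ => chiSmall_nonneg _ _ _) fun c _ =>
    chiSmall_mono_letter _ (mul_le_mul_of_nonneg_right h (sq_nonneg _)) _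

end FrontFactor

section FrontFactorZero

variable (F : T4Family) (N : ℕ) [NeZero N] (ν : Stage7Numerics) (M : ℕ) (g : ℕ → ℝ) (K : ℕ)

/-- **`χ_0 ≡ 1` AT ANY LETTER**: at step 0 the front factor is the empty product (`Ω_0 = ∅` by `Seq.Ω_off`; no cube of positive side lies in `∅`, and there are no
cubes of side 0) — FILE 1's `chiSeqOfRecord_zero`, same proof. [cite: Balaban1988Convergent, (2.18) p.257, (2.1) p.254 (bookkeeping)] -/
theorem chiSeqOfRecordAt_zero (ε : ℝ) (s : SeqOfRecord F ν M g K 0) (V : GaugeField (F.P K) 0 (SU N)) :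
    chiSeqOfRecordAt F N ν M g K 0 ε s V = 1 := by
  rw [chiSeqOfRecordAt, chi218_apply]
  apply Finset.prod_eq_one
  rintro ⟨x, hx⟩ hc
  exfalso
  rw [mem_cubesIn, s.Ω_off 0 (by omega), Set.subset_empty_iff] at hc
  rcases Nat.eq_zero_or_pos (cubeSide (F.P K).L ν.M₂ (RkOfRecord (F.P K).L ν.r (g 0)) 0) with h0 | hpos
  · rw [h0] at hx
    haveI : Nonempty (Fin (F.P K).d) := ⟨⟨0, (F.P K).hd⟩⟩
    simp [cubeIndices] at hx
    exact Finset.notMem_empty x hx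
  · have hmem : cover (F.P K) (fun i => (cubeSide (F.P K).L ν.M₂ (RkOfRecord (F.P K).L ν.r (g 0)) 0 : ℤ) * x i)
        ∈ cubeEnl (F.P K) (cubeSide (F.P K).L ν.M₂ (RkOfRecord (F.P K).L ν.r (g 0)) 0) x 0 := by
      refine ⟨_, fun i => ⟨?_, ?_⟩, rfl⟩
      · simp
      · push_cast
        omega
    rw [hc] at hmem
    exact hmem

end FrontFactorZero

/-! ## §2  The (3.2) factor of a χ_{k+1}-cube AT A LETTER, and the front factor one step up -/

section Factor

variable (F : T4Family) (N : ℕ) [NeZero N] (ν : Stage7Numerics) (M : ℕ) (p : B12.RunParams) (g : ℕ → ℝ) (k : ℕ)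

/-- The ONE (3.2) factor of the χ_{k+1}-cube `□′` AT THRESHOLD `ε`: `χ({sup_{p⊂□′^∼}|U_{k+1,□′}(∂p) − 1| < ε (L⁻¹η)²})(V_{k+1})` with def-R's pins one level up
((2.16) `ukBox` on `□′^{∼4}` with the (2.12) datum `bgOfRecord`, plaquettes `p ⊂ □′^∼`) — `chiFactor` with `ε_{k+1}` a letter (`chiFactor_eq_at`).
[cite: Balaban1988Convergent, (3.2) p.265, (2.16)–(2.17) p.257] -/
def chiFactorAt (ε : ℝ) (c : Iχ F ν p g k) (V' : GaugeField (F.P p.K) (k + 1) (SU N)) : ℝ :=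
  chiSmall (plaqInside (cubeEnl (F.P p.K) (sideχ F ν p g k) c 1))
    (ε * (F.P p.K).eta (k + 1) ^ 2)
    (ukBox (bgOfRecord (avOfRecord F N p.K) {U | PlaqSmall (ν.εreg * (F.P p.K).eta (k + 1) ^ 2) U}) ν.M₁
      (cubeEnl (F.P p.K) (sideχ F ν p g k) c 4) (k + 1) V')

/-- **BRIDGE**: the (3.2) factor of record IS the letter version at `ε_{k+1}` of record (definitional). [cite: Balaban1988Convergent, (3.2) p.265 (bookkeeping)] -/
theorem chiFactor_eq_at : chiFactor F N ν p g k = chiFactorAt F N ν p g k (epsOfRecord ν g (k + 1)) := rfl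

/-- The (3.2) factor at a letter takes values in `{0,1}`: it is idempotent. [cite: Balaban1988Convergent, (3.2) p.265 (bookkeeping)] -/
theorem chiFactorAt_mul_self (ε : ℝ) (c : Iχ F ν p g k) (V' : GaugeField (F.P p.K) (k + 1) (SU N)) :
    chiFactorAt F N ν p g k ε c V' * chiFactorAt F N ν p g k ε c V' = chiFactorAt F N ν p g k ε c V' := by
  unfold chiFactorAt chiSmall; split_ifs <;> norm_num

/-- `0 ≤` the (3.2) factor at a letter. [cite: Balaban1988Convergent, (3.2) p.265 (bookkeeping)] -/
theorem chiFactorAt_nonneg (ε : ℝ) (c : Iχ F ν p g k) (V' : GaugeField (F.P p.K) (k + 1) (SU N)) :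
    0 ≤ chiFactorAt F N ν p g k ε c V' :=
  chiSmall_nonneg _ _ _

/-- The (3.2) factor at a letter is `≤ 1`. [cite: Balaban1988Convergent, (3.2) p.265 (bookkeeping)] -/
theorem chiFactorAt_le_one (ε : ℝ) (c : Iχ F ν p g k) (V' : GaugeField (F.P p.K) (k + 1) (SU N)) :
    chiFactorAt F N ν p g k ε c V' ≤ 1 :=
  chiSmall_le_one _ _ _

/-- The (3.2) factor is monotone in the letter. [cite: Balaban1988Convergent, (3.2) p.265 (bookkeeping)] -/
theorem chiFactorAt_mono {ε ε' : ℝ} (h : ε ≤ ε') (c : Iχ F ν p g k) (V' : GaugeField (F.P p.K) (k + 1) (SU N)) :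
    chiFactorAt F N ν p g k ε c V' ≤ chiFactorAt F N ν p g k ε' c V' :=
  chiSmall_mono_letter _ (mul_le_mul_of_nonneg_right h (sq_nonneg _)) _

/-- **THE FRONT FACTOR ONE STEP UP, AT A LETTER**: `χ_{k+1}(Ω_{k+1})|_ε` on the appended sequence is the product of the (3.2) factors at `ε` over the χ_{k+1}-cubes
inside `Ω_{k+1}(t)` (p. 267) — `chiSeqOfRecord_succ_σOfRecord` with `ε_{k+1}` a letter. [cite: Balaban1988Convergent, (2.17)–(2.18) p.257, p.267] -/
theorem chiSeqOfRecordAt_succ_σOfRecord (ε : ℝ) (s : SeqOfRecord F ν M g p.K k) (t : LbOfRecord F ν p g k)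
    (V' : GaugeField (F.P p.K) (k + 1) (SU N)) :
    chiSeqOfRecordAt F N ν M g p.K (k + 1) ε (σOfRecord F ν M p g k s t) V' =
      ∏ c ∈ cubesIn (cubeχ F ν p g k) (OmegaOfLabel F ν M p g k s t), chiFactorAt F N ν p g k ε c V' := by
  rw [chiSeqOfRecordAt, chi218_apply, σOfRecord_Ω_succ]
  rfl

/-- r11's `χ_{k+1}(X)` of (3.2) on the pinned data AT ANY `ε` is the product of the (3.2) factors at `ε`. [cite: Balaban1988Convergent, (3.2) p.265 (bookkeeping)] -/
theorem chiNext_sect3DataOfRecord_at (ε : ℝ) (s : SeqOfRecord F ν M g p.K k) (X : Finset (Iχ F ν p g k))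
    (V' : GaugeField (F.P p.K) (k + 1) (SU N)) :
    chiNext (sect3DataOfRecord F N ν M p g k s) ε X V' = ∏ c ∈ X, chiFactorAt F N ν p g k ε c V' :=
  rfl

end Factor

/-! ## §3  The label weights AT LETTERS: (3.2) at `ε`, (3.3) at `δ′`, the residual `ζ`; the laws of the `wOfRecord` hand verbatim -/

section Weights

variable (F : T4Family) (N : ℕ) [NeZero N] (ν : Stage7Numerics) (M : ℕ) (p : B12.RunParams) (g : ℕ → ℝ) (k : ℕ)

/-- The (3.2) label weight of `P_{k+1}` AT THRESHOLD `ε`: `[P ⊆ (3.2)-range] · χ_{k+1}(Pᶜ_{k+1})|_ε χᶜ_{k+1}(P_{k+1})|_ε` (r11's `chiNext`∕`chiNextc` on the pinned data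
at `ε`) — `aWeight` with `ε_{k+1}` a letter (`aWeight_eq_at`). [cite: Balaban1988Convergent, (3.2) p.265] -/
def aWeightAt (ε : ℝ) (s : SeqOfRecord F ν M g p.K k) (Pl : Finset (Iχ F ν p g k)) (V' : GaugeField (F.P p.K) (k + 1) (SU N)) : ℝ :=
  if Pl ⊆ cubes32 F ν M p g k s then
    chiNext (sect3DataOfRecord F N ν M p g k s) ε (cubes32 F ν M p g k s \ Pl : Finset (Iχ F ν p g k)) V' *
      chiNextc (sect3DataOfRecord F N ν M p g k s) ε Pl V'
  else 0

/-- The (3.3) label weight of `Q_{k+1}` given `P_{k+1}` AT THRESHOLD `δ′`: `[Q ⊆ (3.3)-range] · χ′_k(Qᶜ_{k+1})|_{δ′} χ′ᶜ_k(Q_{k+1})|_{δ′}` (r11's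
`chiPrime`∕`chiPrimec` on the pinned data with the averaging of record, `δ′` in place of `2δ_k`) — `bWeight` with `2δ_k` a letter (`bWeight_eq_at`).
[cite: Balaban1988Convergent, (3.3)–(3.4) p.265] -/
def bWeightAt (δ' : ℝ) (s : SeqOfRecord F ν M g p.K k) (Pl Ql : Finset (Iχ F ν p g k))
    (U : GaugeField (F.P p.K) k (SU N)) (V' : GaugeField (F.P p.K) (k + 1) (SU N)) : ℝ :=
  if Ql ⊆ qcubes F ν M p g k s Pl then
    chiPrime (sect3DataOfRecord F N ν M p g k s) (avOfRecord F N p.K) δ' (qcubes F ν M p g k s Pl \ Ql : Finset (Iχ F ν p g k)) U V' *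
      chiPrimec (sect3DataOfRecord F N ν M p g k s) (avOfRecord F N p.K) δ' Ql U V'
  else 0

/-- **THE LABEL WEIGHTS AT LETTERS** `ω|_{ε,δ′} s t (U, V') = a|_ε(P)(V') · b|_{δ′}(P,Q)(U,V') · ζ(R,S)(U,V')` — `ωOfRecord` with both thresholds letters
(`ωOfRecord_eq_at`). [cite: Balaban1988Convergent, (3.2)–(3.5) p.265, (3.16) p.268, (3.20)–(3.21) p.269] -/
def ωOfRecordAt (ε δ' : ℝ) (ζ : ZetaOfRecord F N ν M) (s : SeqOfRecord F ν M g p.K k) (t : LbOfRecord F ν p g k)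
    (U : GaugeField (F.P p.K) k (SU N)) (V' : GaugeField (F.P p.K) (k + 1) (SU N)) : ℝ :=
  aWeightAt F N ν M p g k ε s t.1 V' * bWeightAt F N ν M p g k δ' s t.1 t.2.1 U V' * ζ p g k s t.1 t.2.1 t.2.2 U V'

/-- **BRIDGE**: `a(P)` of record IS `a|_ε(P)` at `ε := ε_{k+1}` of record (definitional). [cite: Balaban1988Convergent, (3.2) p.265 (bookkeeping)] -/
theorem aWeight_eq_at : aWeight F N ν M p g k = aWeightAt F N ν M p g k (epsOfRecord ν g (k + 1)) := rfl

/-- **BRIDGE**: `b(P,Q)` of record IS `b|_{δ′}(P,Q)` at `δ′ := 2δ_k` of record (definitional). [cite: Balaban1988Convergent, (3.3)–(3.4) p.265 (bookkeeping)] -/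
theorem bWeight_eq_at (A₁ : ℝ) : bWeight F N ν M p g k A₁ = bWeightAt F N ν M p g k (2 * deltaOfRecord ν g k A₁) := rfl

/-- **BRIDGE**: `ω` of record IS `ω|_{ε,δ′}` at the letters of record (definitional). [cite: Balaban1988Convergent, (3.2)–(3.5) p.265 (bookkeeping)] -/
theorem ωOfRecord_eq_at (A₁ : ℝ) (ζ : ZetaOfRecord F N ν M) :
    ωOfRecord F N ν M p g k A₁ ζ = ωOfRecordAt F N ν M p g k (epsOfRecord ν g (k + 1)) (2 * deltaOfRecord ν g k A₁) ζ := rfl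

/-! ### The two pinned decompositions resolve unity at every letter (r11's `eq32`, `eq33`), and their sizes -/

/-- A sum over all finite subsets with the indicator of `· ⊆ A` is the sum over the powerset of `A`. [folklore] -/
private theorem sum_ite_subset_eq_sum_powerset_at {ι : Type*} [Fintype ι] [DecidableEq ι] (A : Finset ι) (f : Finset ι → ℝ) :
    (∑ X : Finset ι, if X ⊆ A then f X else 0) = ∑ X ∈ A.powerset, f X := by
  rw [← Finset.sum_filter]
  refine Finset.sum_congr ?_ (fun _ _ => rfl)
  ext X
  simp

/-- `Σ_{P_{k+1}} a|_ε(P_{k+1}) = 1` at every letter — (3.2), r11's `eq32` on the pinned data at `ε`. [cite: Balaban1988Convergent, (3.2) p.265] -/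
theorem sum_aWeightAt (ε : ℝ) (s : SeqOfRecord F ν M g p.K k) (V' : GaugeField (F.P p.K) (k + 1) (SU N)) :
    ∑ Pl, aWeightAt F N ν M p g k ε s Pl V' = 1 := by
  classical
  unfold aWeightAt
  rw [sum_ite_subset_eq_sum_powerset_at]
  exact eq32 (sect3DataOfRecord F N ν M p g k s) ε (cubes32 F ν M p g k s) V'

/-- `Σ_{Q_{k+1}} b|_{δ′}(P_{k+1}, Q_{k+1}) = 1` at every letter — (3.3), r11's `eq33` on the pinned data at `δ′`. [cite: Balaban1988Convergent, (3.3) p.265] -/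
theorem sum_bWeightAt (δ' : ℝ) (s : SeqOfRecord F ν M g p.K k) (Pl : Finset (Iχ F ν p g k))
    (U : GaugeField (F.P p.K) k (SU N)) (V' : GaugeField (F.P p.K) (k + 1) (SU N)) :
    ∑ Ql, bWeightAt F N ν M p g k δ' s Pl Ql U V' = 1 := by
  classical
  unfold bWeightAt
  rw [sum_ite_subset_eq_sum_powerset_at]
  exact eq33 (sect3DataOfRecord F N ν M p g k s) (avOfRecord F N p.K) δ' Pl U V'

/-- `0 ≤ a|_ε(P)`. [cite: Balaban1988Convergent, (3.2) p.265 (bookkeeping)] -/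
theorem aWeightAt_nonneg (ε : ℝ) (s : SeqOfRecord F ν M g p.K k) (Pl : Finset (Iχ F ν p g k))
    (V' : GaugeField (F.P p.K) (k + 1) (SU N)) : 0 ≤ aWeightAt F N ν M p g k ε s Pl V' := by
  classical
  unfold aWeightAt
  split_ifs
  · refine mul_nonneg ?_ ?_
    · rw [chiNext_sect3DataOfRecord_at]
      exact Finset.prod_nonneg fun c _ => chiFactorAt_nonneg F N ν p g k ε c V'
    · unfold chiNextc
      exact Finset.prod_nonneg fun c _ => sub_nonneg.2 (chiFactorAt_le_one F N ν p g k ε c V')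
  · exact le_rfl

/-- `0 ≤ b|_{δ′}(P, Q)`. [cite: Balaban1988Convergent, (3.3) p.265 (bookkeeping)] -/
theorem bWeightAt_nonneg (δ' : ℝ) (s : SeqOfRecord F ν M g p.K k) (Pl Ql : Finset (Iχ F ν p g k))
    (U : GaugeField (F.P p.K) k (SU N)) (V' : GaugeField (F.P p.K) (k + 1) (SU N)) :
    0 ≤ bWeightAt F N ν M p g k δ' s Pl Ql U V' := by
  classical
  unfold bWeightAt chiPrime chiPrimec
  split_ifs
  · exact mul_nonneg (Finset.prod_nonneg fun c _ => by split_ifs <;> norm_num)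
      (Finset.prod_nonneg fun c _ => by split_ifs <;> norm_num)
  · exact le_rfl

/-- Absorbing a sub-product of idempotent factors: `(Π_X f)(Π_Y f) = Π_Y f` for `X ⊆ Y`, `f·f = f`. [folklore] -/
private theorem prod_mul_prod_of_subset_of_mul_self_at {ι : Type*} {X Y : Finset ι} (h : X ⊆ Y) (f : ι → ℝ)
    (hf : ∀ c, f c * f c = f c) : (∏ c ∈ X, f c) * ∏ c ∈ Y, f c = ∏ c ∈ Y, f c := by
  classical
  rw [← Finset.prod_sdiff h, mul_comm (∏ c ∈ Y \ X, f c), ← mul_assoc, ← Finset.prod_mul_distrib,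
    Finset.prod_congr rfl fun c _ => hf c]

/-- **FRONT-FACTOR ABSORPTION AT A LETTER**: `χ_{k+1}(Ω_{k+1}(t))|_ε(V') · a|_ε(P_{k+1})(V') = a|_ε(P_{k+1})(V')` — ONE letter `ε` for the (2.17)_{k+1} front
factor and the (3.2) decomposition, as in print where both read `ε_{k+1}`; the χ_{k+1}-cubes inside `Ω_{k+1}(t)` are (3.2)-cubes outside `P_{k+1}` and the
factors are idempotent. [cite: Balaban1988Convergent, (3.2) p.265, p.267] -/
theorem front_absorb_at (ε : ℝ) (s : SeqOfRecord F ν M g p.K k) (t : LbOfRecord F ν p g k)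
    (V' : GaugeField (F.P p.K) (k + 1) (SU N)) :
    chiSeqOfRecordAt F N ν M g p.K (k + 1) ε (σOfRecord F ν M p g k s t) V' * aWeightAt F N ν M p g k ε s t.1 V' =
      aWeightAt F N ν M p g k ε s t.1 V' := by
  by_cases hP : t.1 ⊆ cubes32 F ν M p g k s
  · rw [aWeightAt, if_pos hP, chiSeqOfRecordAt_succ_σOfRecord, chiNext_sect3DataOfRecord_at, ← mul_assoc]
    congr 1
    exact prod_mul_prod_of_subset_of_mul_self_at (cubesIn_OmegaOfLabel_subset F ν M p g k s t)
      (fun c => chiFactorAt F N ν p g k ε c V') (fun c => chiFactorAt_mul_self F N ν p g k ε c V')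
  · rw [aWeightAt, if_neg hP, mul_zero]

/-! ### (O2), (O3) at letters -/

/-- **(O2) LABEL-LEVEL UNITY AT LETTERS, POINTWISE**: `Σ_t χ_{k+1}(Ω_{k+1}(t))|_ε(V') · ω|_{ε,δ′} s t (U, V') = 1` for all `U, V'` — (3.2) at `ε` ∘ (3.3) at `δ′`
∘ the ζ-law. [cite: Balaban1988Convergent, (3.2)–(3.5) p.265, (3.16) p.268, (3.20)–(3.21) p.269, §3 p.267] -/
theorem labelUnity_ωOfRecordAt (ε δ' : ℝ) {ζ : ZetaOfRecord F N ν M} (hζ : IsZetaUnity F N ν M ζ)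
    (s : SeqOfRecord F ν M g p.K k) (U : GaugeField (F.P p.K) k (SU N)) (V' : GaugeField (F.P p.K) (k + 1) (SU N)) :
    ∑ t : LbOfRecord F ν p g k,
        chiSeqOfRecordAt F N ν M g p.K (k + 1) ε (σOfRecord F ν M p g k s t) V' * ωOfRecordAt F N ν M p g k ε δ' ζ s t U V' = 1 := by
  have key : ∀ t : LbOfRecord F ν p g k,
      chiSeqOfRecordAt F N ν M g p.K (k + 1) ε (σOfRecord F ν M p g k s t) V' * ωOfRecordAt F N ν M p g k ε δ' ζ s t U V' =
        aWeightAt F N ν M p g k ε s t.1 V' *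
          (bWeightAt F N ν M p g k δ' s t.1 t.2.1 U V' * ζ p g k s t.1 t.2.1 t.2.2 U V') := by
    intro t
    rw [ωOfRecordAt, ← mul_assoc, ← mul_assoc, front_absorb_at, mul_assoc]
  have hz : ∀ Pl Ql : Finset (Iχ F ν p g k), ∑ R, ∑ S, ζ p g k s Pl Ql (R, S) U V' = 1 := fun Pl Ql => by
    rw [← hζ p g k s Pl Ql U V', Fintype.sum_prod_type]
  calc ∑ t : LbOfRecord F ν p g k,
        chiSeqOfRecordAt F N ν M g p.K (k + 1) ε (σOfRecord F ν M p g k s t) V' * ωOfRecordAt F N ν M p g k ε δ' ζ s t U V'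
      = ∑ t : LbOfRecord F ν p g k,
          aWeightAt F N ν M p g k ε s t.1 V' *
            (bWeightAt F N ν M p g k δ' s t.1 t.2.1 U V' * ζ p g k s t.1 t.2.1 t.2.2 U V') :=
        Finset.sum_congr rfl fun t _ => key t
    _ = ∑ Pl, ∑ Ql, ∑ R, ∑ S, aWeightAt F N ν M p g k ε s Pl V' *
          (bWeightAt F N ν M p g k δ' s Pl Ql U V' * ζ p g k s Pl Ql (R, S) U V') := by
        simp only [Fintype.sum_prod_type]
    _ = ∑ Pl, aWeightAt F N ν M p g k ε s Pl V' * ∑ Ql, bWeightAt F N ν M p g k δ' s Pl Ql U V' *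
          ∑ R, ∑ S, ζ p g k s Pl Ql (R, S) U V' := by
        simp only [Finset.mul_sum]
    _ = 1 := by
        simp only [hz, mul_one, sum_bWeightAt]
        exact sum_aWeightAt F N ν M p g k ε s V'

/-- **(O3) AT LETTERS** `Σ_t |ω|_{ε,δ′} s t (U, V')| ≤ 1`. [cite: Balaban1988Convergent, (3.2)–(3.3) p.265, (3.16) p.268 (bookkeeping)] -/
theorem sum_abs_ωOfRecordAt_le_one (ε δ' : ℝ) {ζ : ZetaOfRecord F N ν M} (hζ : IsZetaAbsLeOne F N ν M ζ)
    (s : SeqOfRecord F ν M g p.K k) (U : GaugeField (F.P p.K) k (SU N)) (V' : GaugeField (F.P p.K) (k + 1) (SU N)) :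
    ∑ t : LbOfRecord F ν p g k, |ωOfRecordAt F N ν M p g k ε δ' ζ s t U V'| ≤ 1 := by
  have key : ∀ t : LbOfRecord F ν p g k, |ωOfRecordAt F N ν M p g k ε δ' ζ s t U V'| =
      aWeightAt F N ν M p g k ε s t.1 V' *
        (bWeightAt F N ν M p g k δ' s t.1 t.2.1 U V' * |ζ p g k s t.1 t.2.1 t.2.2 U V'|) := by
    intro t
    rw [ωOfRecordAt, abs_mul, abs_mul, abs_of_nonneg (aWeightAt_nonneg F N ν M p g k ε s t.1 V'),
      abs_of_nonneg (bWeightAt_nonneg F N ν M p g k δ' s t.1 t.2.1 U V'), mul_assoc]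
  have hz : ∀ Pl Ql : Finset (Iχ F ν p g k), ∑ R, ∑ S, |ζ p g k s Pl Ql (R, S) U V'| ≤ 1 := fun Pl Ql => by
    have h := hζ p g k s Pl Ql U V'
    rwa [Fintype.sum_prod_type] at h
  calc ∑ t : LbOfRecord F ν p g k, |ωOfRecordAt F N ν M p g k ε δ' ζ s t U V'|
      = ∑ t : LbOfRecord F ν p g k,
          aWeightAt F N ν M p g k ε s t.1 V' *
            (bWeightAt F N ν M p g k δ' s t.1 t.2.1 U V' * |ζ p g k s t.1 t.2.1 t.2.2 U V'|) :=
        Finset.sum_congr rfl fun t _ => key t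
    _ = ∑ Pl, ∑ Ql, ∑ R, ∑ S, aWeightAt F N ν M p g k ε s Pl V' *
          (bWeightAt F N ν M p g k δ' s Pl Ql U V' * |ζ p g k s Pl Ql (R, S) U V'|) := by
        simp only [Fintype.sum_prod_type]
    _ = ∑ Pl, aWeightAt F N ν M p g k ε s Pl V' * ∑ Ql, bWeightAt F N ν M p g k δ' s Pl Ql U V' *
          ∑ R, ∑ S, |ζ p g k s Pl Ql (R, S) U V'| := by
        simp only [Finset.mul_sum]
    _ ≤ ∑ Pl, aWeightAt F N ν M p g k ε s Pl V' * ∑ Ql, bWeightAt F N ν M p g k δ' s Pl Ql U V' * 1 := by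
        refine Finset.sum_le_sum fun Pl _ => mul_le_mul_of_nonneg_left ?_ (aWeightAt_nonneg F N ν M p g k ε s Pl V')
        exact Finset.sum_le_sum fun Ql _ =>
          mul_le_mul_of_nonneg_left (hz Pl Ql) (bWeightAt_nonneg F N ν M p g k δ' s Pl Ql U V')
    _ = 1 := by
        simp only [mul_one, sum_bWeightAt]
        exact sum_aWeightAt F N ν M p g k ε s V'

end Weights

/-! ## §4  Threshold letters, the letters OF RECORD, and the step weights AT LETTERS with their three provisos -/

/-- A THRESHOLD LETTER: per run, coupling sequence and level, a real threshold (the shape of `ε_j` of (2.17)∕(3.2) and of `2δ_j` of (3.3)∕(3.4) read as free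
letters; the selection of an admissible box of letters is the consumers'). [cite: Balaban1988Convergent, (2.17) p.257, (3.2)–(3.4) p.265 (bookkeeping)] -/
abbrev ThresholdLetter : Type :=
  B12.RunParams → (ℕ → ℝ) → ℕ → ℝ

/-- THE (2.17)∕(3.2) LETTER OF RECORD: `(p, g, j) ↦ ε_j = epsOfRecord ν g j` (def-R's threshold of record, `g_j`-profile of [I] (1.16)).
[cite: Balaban1988Convergent, (2.17) p.257, (3.2) p.265; Balaban1987RG1, (1.16) p.262] -/
def epsLetterOfRecord (ν : Stage7Numerics) : ThresholdLetter :=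
  fun _ g j => epsOfRecord ν g j

/-- THE (3.3)∕(3.4) LETTER OF RECORD: `(p, g, j) ↦ 2δ_j`, `δ_j = g_j A₁∕(A₀ p₀(g_j))` (`deltaOfRecord`; `A₁` of [I] (1.16) a parameter).
[cite: Balaban1988Convergent, (3.3)–(3.4) p.265] -/
def twoDeltaLetterOfRecord (ν : Stage7Numerics) (A₁ : ℝ) : ThresholdLetter :=
  fun _ g j => 2 * deltaOfRecord ν g j A₁

section OfRecordAt

variable (F : T4Family) (N : ℕ) [NeZero N] (ν : Stage7Numerics) (M : ℕ)

/-- **THE STEP WEIGHTS AT LETTERS** `wOfRecordAt Θ Δ ζ`: FILE 2's `stepWeightsOfResum` at the labels `(P,Q,R,S)_{k+1}`, the index map (3.5)∕(3.20) and the label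
weights at letters — step `k` reads the (3.2) letter at level `k+1` (`Θ p g (k+1)`, print's `ε_{k+1}`) and the (3.3) letter at level `k` (`Δ p g k`, print's `2δ_k`);
`wOfRecord A₁ ζ` is the instance at the letters of record (`wOfRecord_eq_at`). [cite: Balaban1988Convergent, (3.2)–(3.5) p.265, (3.16) p.268, (3.20)–(3.21) p.269, §3 p.267, p.270] -/
def wOfRecordAt (Θ Δ : ThresholdLetter) (ζ : ZetaOfRecord F N ν M) : StepWeightsOfRecord F N ν M :=
  stepWeightsOfResum F N ν M (LbOfRecord F ν) (σOfRecord F ν M)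
    (fun p g k => ωOfRecordAt F N ν M p g k (Θ p g (k + 1)) (Δ p g k) ζ)

/-- **BRIDGE**: the step weights of record ARE the step weights at the letters of record (definitional).
[cite: Balaban1988Convergent, (3.2)–(3.5) p.265 (bookkeeping)] -/
theorem wOfRecord_eq_at (A₁ : ℝ) (ζ : ZetaOfRecord F N ν M) :
    wOfRecord F N ν M A₁ ζ = wOfRecordAt F N ν M (epsLetterOfRecord ν) (twoDeltaLetterOfRecord ν A₁) ζ := rfl

/-- Unfolding of `wOfRecordAt` at `(p, g, k)`. [cite: Balaban1988Convergent, §3 p.267 (bookkeeping)] -/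
theorem wOfRecordAt_apply (Θ Δ : ThresholdLetter) (ζ : ZetaOfRecord F N ν M) (p : B12.RunParams) (g : ℕ → ℝ) (k : ℕ) :
    wOfRecordAt F N ν M Θ Δ ζ p g k = resumWeights (σOfRecord F ν M p g k) (ωOfRecordAt F N ν M p g k (Θ p g (k + 1)) (Δ p g k) ζ) := rfl

/-- **THE UNITY LAW OF THE STEP WEIGHTS AT LETTERS** (FILE 1's `IsStepUnity`) against the front factors AT THE SAME LETTER, `χ_k|_{Θ_k}` and `χ_{k+1}|_{Θ_{k+1}}`:
from the label-level unity (O2) at letters by FILE 2's `isStepUnity_resumWeights`, modulo the displayed ζ-law.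
[cite: Balaban1988Convergent, (3.2)–(3.5) p.265, (3.6)–(3.9) pp.265–266, (3.16) p.268, (3.20) p.269] -/
theorem isStepUnity_wOfRecordAt (Θ Δ : ThresholdLetter) {ζ : ZetaOfRecord F N ν M} (hζ : IsZetaUnity F N ν M ζ)
    (p : B12.RunParams) (g : ℕ → ℝ) (k : ℕ) :
    IsStepUnity (avOfRecord F N p.K k).avg (chiSeqOfRecordAt F N ν M g p.K k (Θ p g k))
      (chiSeqOfRecordAt F N ν M g p.K (k + 1) (Θ p g (k + 1))) (wOfRecordAt F N ν M Θ Δ ζ p g k) := by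
  rw [wOfRecordAt_apply]
  refine isStepUnity_resumWeights _ _ _ (σOfRecord F ν M p g k) _ (fun s t => init_σOfRecord F ν M p g k s t) (fun s U => ?_)
  rw [labelUnity_ωOfRecordAt F N ν M p g k (Θ p g (k + 1)) (Δ p g k) hζ s U ((avOfRecord F N p.K k).avg U), mul_one]

/-- **`|w| ≤ 1`** for the step weights at letters (the `absW_le` proviso), modulo the displayed ζ-size law.
[cite: Balaban1988Convergent, (3.2)–(3.3) p.265 (bookkeeping)] -/
theorem abs_wOfRecordAt_le_one (Θ Δ : ThresholdLetter) {ζ : ZetaOfRecord F N ν M} (hζ : IsZetaAbsLeOne F N ν M ζ)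
    (p : B12.RunParams) (g : ℕ → ℝ) (k : ℕ) (s' : SeqOfRecord F ν M g p.K (k + 1))
    (U : GaugeField (F.P p.K) k (SU N)) (V' : GaugeField (F.P p.K) (k + 1) (SU N)) :
    |wOfRecordAt F N ν M Θ Δ ζ p g k s' U V'| ≤ 1 := by
  rw [wOfRecordAt_apply]
  exact abs_resumWeights_le_one _ _ (fun s U V' => sum_abs_ωOfRecordAt_le_one F N ν M p g k _ _ hζ s U V') s' U V'

/-- **Joint measurability of the step weights at letters** (the `measW` proviso) from the DISPLAYED joint measurability of the label weights at letters
((O4)-shape; discharged under (H-U) ∧ (H-ζ) in §6). [cite: Balaban1988Convergent, (3.2)–(3.3) p.265 (bookkeeping)] -/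
theorem measurable_wOfRecordAt (Θ Δ : ThresholdLetter) (ζ : ZetaOfRecord F N ν M) (p : B12.RunParams) (g : ℕ → ℝ) (k : ℕ)
    (hω : ∀ (s : SeqOfRecord F ν M g p.K k) (t : LbOfRecord F ν p g k),
      Measurable (fun z : GaugeField (F.P p.K) (k + 1) (SU N) × GaugeField (F.P p.K) k (SU N) =>
        ωOfRecordAt F N ν M p g k (Θ p g (k + 1)) (Δ p g k) ζ s t z.2 z.1))
    (s' : SeqOfRecord F ν M g p.K (k + 1)) :
    Measurable (fun z : GaugeField (F.P p.K) (k + 1) (SU N) × GaugeField (F.P p.K) k (SU N) =>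
      wOfRecordAt F N ν M Θ Δ ζ p g k s' z.2 z.1) := by
  rw [wOfRecordAt_apply]
  exact measurable_resumWeights _ _ hω s'

end OfRecordAt

/-! ## §5  The T-step (3.1), the represented tower and the assembled density (2.18) AT LETTERS -/

section TStepAt

variable (F : T4Family) (N : ℕ) [NeZero N] (ν : Stage7Numerics) (M : ℕ)

/-- **THE T-STEP AT LETTERS** on a level-k slot: (†) along `avOfRecord` with the old front factor `χ_k|_{Θ_k}` (`chiSeqOfRecordAt … k (Θ p g k)`) and the step
weights `w` — FILE 1's `tstepOfRecord` with `ε_k` a letter (`tstepOfRecord_eq_at`). [cite: Balaban1988Convergent, (3.1) p.264, (3.24)–(3.25) p.270] -/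
def tstepOfRecordAt (Θ : ThresholdLetter) (w : StepWeightsOfRecord F N ν M) (p : B12.RunParams) (g : ℕ → ℝ) (k : ℕ)
    (T : SeqOfRecord F ν M g p.K k → Density (F.P p.K) k (SU N)) :
    SeqOfRecord F ν M g p.K (k + 1) → Density (F.P p.K) (k + 1) (SU N) :=
  texpASucc (avOfRecord F N p.K k).avg (chiSeqOfRecordAt F N ν M g p.K k (Θ p g k)) T (w p g k)

/-- **BRIDGE**: the T-step of record IS the T-step at the (2.17) letter of record (definitional). [cite: Balaban1988Convergent, (3.1) p.264 (bookkeeping)] -/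
theorem tstepOfRecord_eq_at (w : StepWeightsOfRecord F N ν M) :
    tstepOfRecord F N ν M w = tstepOfRecordAt F N ν M (epsLetterOfRecord ν) w := rfl

/-- Unfolding of the T-step at letters through `transportOfRecord`. [cite: Balaban1988Convergent, (3.1) p.264 (bookkeeping)] -/
theorem tstepOfRecordAt_apply (Θ : ThresholdLetter) (w : StepWeightsOfRecord F N ν M) (p : B12.RunParams) (g : ℕ → ℝ) (k : ℕ)
    (T : SeqOfRecord F ν M g p.K k → Density (F.P p.K) k (SU N)) (s' : SeqOfRecord F ν M g p.K (k + 1))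
    (V' : GaugeField (F.P p.K) (k + 1) (SU N)) :
    tstepOfRecordAt F N ν M Θ w p g k T s' V' =
      transportOfRecord F N p.K k
        (fun U => w p g k s' U V' * (chiSeqOfRecordAt F N ν M g p.K k (Θ p g k) s'.init U * T s'.init U)) V' := rfl

/-- **THE T-STEP AT LETTERS IS AN RT** at the level of assembled densities, the new front factors read at the same letter one level up: from the DISPLAYED unity
law, for `k < K`, integrable level-k pieces, bounded jointly measurable weights and measurable new front factors — FILE 1's `isRT_tstepOfRecord` at letters.
[cite: Balaban1988Convergent, (3.1) p.264, (3.25) p.270] -/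
theorem isRT_tstepOfRecordAt (Θ : ThresholdLetter) (w : StepWeightsOfRecord F N ν M) (p : B12.RunParams) (g : ℕ → ℝ) (k : ℕ)
    (hk : k < p.K) (T : SeqOfRecord F ν M g p.K k → Density (F.P p.K) k (SU N))
    (hT : ∀ s, Integrable (fun U => chiSeqOfRecordAt F N ν M g p.K k (Θ p g k) s U * T s U) (fieldMeasure (F.P p.K) k (SU N)))
    (hw : ∀ s', Measurable
      (fun z : GaugeField (F.P p.K) (k + 1) (SU N) × GaugeField (F.P p.K) k (SU N) => w p g k s' z.2 z.1))
    (hwb : ∀ s' U V', |w p g k s' U V'| ≤ 1)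
    (hχ : ∀ s', Measurable (chiSeqOfRecordAt F N ν M g p.K (k + 1) (Θ p g (k + 1)) s'))
    (hunit : IsStepUnity (avOfRecord F N p.K k).avg (chiSeqOfRecordAt F N ν M g p.K k (Θ p g k))
      (chiSeqOfRecordAt F N ν M g p.K (k + 1) (Θ p g (k + 1))) (w p g k)) :
    IsRT (avOfRecord F N p.K k).avg (fun U => ∑ s, chiSeqOfRecordAt F N ν M g p.K k (Θ p g k) s U * T s U)
      (fun V' => ∑ s', chiSeqOfRecordAt F N ν M g p.K (k + 1) (Θ p g (k + 1)) s' V' *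
        tstepOfRecordAt F N ν M Θ w p g k T s' V') :=
  isRT_sum_texpASucc (avOfRecord_measurable F N p.K k) (avOfRecord_haarAC F N p.K k hk) _ T _ _ hT hw hwb hχ
    (fun s' V' => abs_chiSeqOfRecordAt_le_one F N ν M g p.K (k + 1) (Θ p g (k + 1)) s' V') hunit

/-- **THE T-STEP AT LETTERS OF AN INTEGRABLE PIECE IS INTEGRABLE** (`k < K`; K0′-G3's (P1) `integrable_tstepOfRecord` at letters): disintegration of the joint law
of `(Ū, U)`, `HaarAC` of the averaging of record, NO bound on the marginal density. [cite: Balaban1988Convergent, (3.1) p.264, (3.24)–(3.25) p.270 (bookkeeping)] -/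
theorem integrable_tstepOfRecordAt (Θ : ThresholdLetter) {p : B12.RunParams} {g : ℕ → ℝ} {k : ℕ} (hk : k < p.K)
    {w : StepWeightsOfRecord F N ν M}
    (hw : ∀ s', Measurable (fun z : GaugeField (F.P p.K) (k + 1) (SU N) × GaugeField (F.P p.K) k (SU N) => w p g k s' z.2 z.1))
    (hwb : ∀ s' U V', |w p g k s' U V'| ≤ 1) {T : SeqOfRecord F ν M g p.K k → Density (F.P p.K) k (SU N)}
    (hT : ∀ s, Integrable (fun U => chiSeqOfRecordAt F N ν M g p.K k (Θ p g k) s U * T s U) (fieldMeasure (F.P p.K) k (SU N)))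
    (s' : SeqOfRecord F ν M g p.K (k + 1)) :
    Integrable (tstepOfRecordAt F N ν M Θ w p g k T s') (fieldMeasure (F.P p.K) (k + 1) (SU N)) := by
  have e : tstepOfRecordAt F N ν M Θ w p g k T s' = fun V' => (avgDensity (avOfRecord F N p.K k).avg V' : ℝ) *
      ∫ U, (chiSeqOfRecordAt F N ν M g p.K k (Θ p g k) s'.init U * T s'.init U) *
        (fun z : GaugeField (F.P p.K) (k + 1) (SU N) × GaugeField (F.P p.K) k (SU N) => w p g k s' z.2 z.1) (V', U)
          ∂(avgKernel (avOfRecord F N p.K k).avg V') := by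
    funext V'; rw [show tstepOfRecordAt F N ν M Θ w p g k T s' V' = _ from texpASucc_apply _ _ _ _ s' V']
    exact congrArg _ (integral_congr_ae (ae_of_all _ fun U => mul_comm _ _))
  rw [e]
  exact integrable_transport_piece (avOfRecord_measurable F N p.K k) (avOfRecord_haarAC F N p.K k hk) (hT s'.init) (hw s')
    (C := 1) (fun z => by rw [Real.norm_eq_abs]; exact hwb s' z.2 z.1)

/-- **THE SLOT FAMILY OF THE REPRESENTED TOWER AT LETTERS** (post-𝐑), by recursion on the step: level 0 = the one-term representation of `ρ₀ = rhoZeroOfRecord`;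
level k+1 = the R-step `R` (a slot-operation PARAMETER, as in FILE 1) applied to the T-step AT LETTERS of level k — `texpAOfRecord` with `ε_k` a letter
(`texpAOfRecord_eq_at`). [cite: Balaban1988Convergent, (2.18) p.257, (3.24) p.270; Balaban1989LargeFieldI, (0.3) p.176] -/
def texpAOfRecordAt (Θ : ThresholdLetter) (E : B12.RunParams → ℝ) (w : StepWeightsOfRecord F N ν M) (R : SliceOpOfRecord F N ν M) :
    TexpAOfRecord F N ν M :=
  fun p g k => Nat.rec (motive := fun k => SeqOfRecord F ν M g p.K k → Density (F.P p.K) k (SU N))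
    (fun _ => rhoZeroOfRecord F N p.K (g 0) (E p))
    (fun k T => R p g (k + 1) (tstepOfRecordAt F N ν M Θ w p g k T)) k

/-- THE PRE-𝐑 SLOT AT LETTERS at level k+1: the T-step at letters of the tower's level-k slot. [cite: Balaban1988Convergent, (3.24)–(3.25) p.270] -/
def texpATOfRecordAt (Θ : ThresholdLetter) (E : B12.RunParams → ℝ) (w : StepWeightsOfRecord F N ν M) (R : SliceOpOfRecord F N ν M)
    (p : B12.RunParams) (g : ℕ → ℝ) (k : ℕ) : SeqOfRecord F ν M g p.K (k + 1) → Density (F.P p.K) (k + 1) (SU N) :=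
  tstepOfRecordAt F N ν M Θ w p g k (texpAOfRecordAt F N ν M Θ E w R p g k)

/-- **BRIDGE**: the slot family of record IS the slot family at the (2.17) letter of record (definitional). [cite: Balaban1988Convergent, (3.24) p.270 (bookkeeping)] -/
theorem texpAOfRecord_eq_at (E : B12.RunParams → ℝ) (w : StepWeightsOfRecord F N ν M) (R : SliceOpOfRecord F N ν M) :
    texpAOfRecord F N ν M E w R = texpAOfRecordAt F N ν M (epsLetterOfRecord ν) E w R := rfl

/-- **BRIDGE** for the pre-𝐑 slot (definitional). [cite: Balaban1988Convergent, (3.25) p.270 (bookkeeping)] -/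
theorem texpATOfRecord_eq_at (E : B12.RunParams → ℝ) (w : StepWeightsOfRecord F N ν M) (R : SliceOpOfRecord F N ν M) :
    texpATOfRecord F N ν M E w R = texpATOfRecordAt F N ν M (epsLetterOfRecord ν) E w R := rfl

/-- Level 0 of the slot family at letters is `ρ₀` on every (length-0) sequence. [cite: Balaban1988Convergent, (2.18) p.257 (bookkeeping)] -/
theorem texpAOfRecordAt_zero (Θ : ThresholdLetter) (E : B12.RunParams → ℝ) (w : StepWeightsOfRecord F N ν M) (R : SliceOpOfRecord F N ν M)
    (p : B12.RunParams) (g : ℕ → ℝ) (s : SeqOfRecord F ν M g p.K 0) :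
    texpAOfRecordAt F N ν M Θ E w R p g 0 s = rhoZeroOfRecord F N p.K (g 0) (E p) := rfl

/-- Level k+1 of the slot family at letters is the R-step of the pre-𝐑 slot at letters. [cite: Balaban1989LargeFieldI, (0.3) p.176 (bookkeeping)] -/
theorem texpAOfRecordAt_succ (Θ : ThresholdLetter) (E : B12.RunParams → ℝ) (w : StepWeightsOfRecord F N ν M) (R : SliceOpOfRecord F N ν M)
    (p : B12.RunParams) (g : ℕ → ℝ) (k : ℕ) :
    texpAOfRecordAt F N ν M Θ E w R p g (k + 1) = R p g (k + 1) (texpATOfRecordAt F N ν M Θ E w R p g k) := rfl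

/-- **THE (2.18) DATUM AT LETTERS** at run `p`, couplings `g`, step `k`: index = sequences of record, `χ` = `χ_k|_{Θ_k}`, `𝐓exp A` = the residual data, last
large-field region `Z_k = Λ_kᶜ` — def-R's `repr218OfRecord` with `ε_k` a letter (`repr218OfRecord_eq_at`). [cite: Balaban1988Convergent, (2.18) p.257, (2.3) p.255] -/
def repr218OfRecordAt (Θ : ThresholdLetter) (texpA : TexpAOfRecord F N ν M) (p : B12.RunParams) (g : ℕ → ℝ) (k : ℕ) :
    Step.Repr218 (F.P p.K) (SU N) k where
  Adm := SeqOfRecord F ν M g p.K k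
  Zs := Set (Site (F.P p.K) 0)
  finZs := Fintype.ofFinite _
  decZs := Classical.decEq _
  χ := chiSeqOfRecordAt F N ν M g p.K k (Θ p g k)
  TexpA := texpA p g k
  lastZ s := (s.Λ k)ᶜ

/-- **BRIDGE**: the (2.18) datum of record IS the datum at the letter of record (definitional). [cite: Balaban1988Convergent, (2.18) p.257 (bookkeeping)] -/
theorem repr218OfRecord_eq_at (texpA : TexpAOfRecord F N ν M) (p : B12.RunParams) (g : ℕ → ℝ) (k : ℕ) :
    repr218OfRecord F N ν M texpA p g k = repr218OfRecordAt F N ν M (epsLetterOfRecord ν) texpA p g k := rfl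

/-- **THE ASSEMBLED DENSITY AT LETTERS**: `Σ_s χ_k(s)|_{Θ_k}(V) · (𝐓_k(s) exp A_k(s))(V)` — the right side of (2.18) with `ε_k` a letter (`densityOfRepr_eq_at`).
[cite: Balaban1988Convergent, (2.18) p.257] -/
def densityOfReprAt (Θ : ThresholdLetter) (texpA : TexpAOfRecord F N ν M) (p : B12.RunParams) (g : ℕ → ℝ) (k : ℕ) :
    Density (F.P p.K) k (SU N) :=
  fun V => ∑ s : SeqOfRecord F ν M g p.K k, chiSeqOfRecordAt F N ν M g p.K k (Θ p g k) s V * texpA p g k s V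

/-- **BRIDGE**: the assembled density of record IS the assembled density at the letter of record (definitional). [cite: Balaban1988Convergent, (2.18) p.257 (bookkeeping)] -/
theorem densityOfRepr_eq_at (texpA : TexpAOfRecord F N ν M) :
    densityOfRepr F N ν M texpA = densityOfReprAt F N ν M (epsLetterOfRecord ν) texpA := rfl

/-- The assembled density at letters satisfies (2.18) for the datum at letters (by construction). [cite: Balaban1988Convergent, (2.18) p.257 (bookkeeping)] -/
theorem holds_densityOfReprAt (Θ : ThresholdLetter) (texpA : TexpAOfRecord F N ν M) (p : B12.RunParams) (g : ℕ → ℝ) (k : ℕ) :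
    (repr218OfRecordAt F N ν M Θ texpA p g k).Holds (densityOfReprAt F N ν M Θ texpA p g k) := by
  intro V
  unfold repr218OfRecordAt densityOfReprAt
  rfl

/-- **`eval_zero` AT LETTERS**: the assembled density of the represented tower at letters at step 0 IS `ρ₀` (one term, `χ_0 ≡ 1` at any letter).
[cite: Balaban1988Convergent, Thm 1 p.262, (2.18) p.257] -/
theorem densityOfReprAt_texpAOfRecordAt_zero (Θ : ThresholdLetter) (E : B12.RunParams → ℝ) (w : StepWeightsOfRecord F N ν M)
    (R : SliceOpOfRecord F N ν M) (p : B12.RunParams) (g : ℕ → ℝ) :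
    densityOfReprAt F N ν M Θ (texpAOfRecordAt F N ν M Θ E w R) p g 0 = rhoZeroOfRecord F N p.K (g 0) (E p) := by
  funext V
  rw [densityOfReprAt]
  simp only [Seq.sum_seq_zero, chiSeqOfRecordAt_zero, one_mul]
  rfl

end TStepAt

section TowerAt

variable (F : T4Family) (N : ℕ) [NeZero N] (ν : Stage7Numerics) (τ : TowerNumerics)

/-- **THE POST-𝐑 SLOT FAMILY OF RECORD AT LETTERS**: FILE 2's `slotsOfRecord` with the T-steps at letters (R-step of record `rstepSlotOfRecord`, its own pins
untouched). [cite: Balaban1988Convergent, (2.18) p.257, (3.24) p.270; Balaban1989LargeFieldI, (0.3) p.176] -/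
def slotsOfRecordAt (Θ : ThresholdLetter) (E : B12.RunParams → ℝ) (w : StepWeightsOfRecord F N ν τ.M) (ppSel : PpSelOfRecord F ν τ.M) :
    TexpAOfRecord F N ν τ.M :=
  texpAOfRecordAt F N ν τ.M Θ E w (rstepSlotOfRecord F N ν τ ppSel)

/-- **BRIDGE** (definitional). [cite: Balaban1988Convergent, (3.24) p.270 (bookkeeping)] -/
theorem slotsOfRecord_eq_at (E : B12.RunParams → ℝ) (w : StepWeightsOfRecord F N ν τ.M) (ppSel : PpSelOfRecord F ν τ.M) :
    slotsOfRecord F N ν τ E w ppSel = slotsOfRecordAt F N ν τ (epsLetterOfRecord ν) E w ppSel := rfl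

/-- **THE PRE-𝐑 SLOT FAMILY OF RECORD AT LETTERS**: level 0 = the start, level k+1 = the T-step at letters of the post-𝐑 level k.
[cite: Balaban1988Convergent, (3.24)–(3.25) p.270; Balaban1989LargeFieldI, (0.2) p.176] -/
def slotsTOfRecordAt (Θ : ThresholdLetter) (E : B12.RunParams → ℝ) (w : StepWeightsOfRecord F N ν τ.M) (ppSel : PpSelOfRecord F ν τ.M) :
    TexpAOfRecord F N ν τ.M
  | p, g, 0 => slotsOfRecordAt F N ν τ Θ E w ppSel p g 0
  | p, g, k + 1 => texpATOfRecordAt F N ν τ.M Θ E w (rstepSlotOfRecord F N ν τ ppSel) p g k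

/-- **BRIDGE** (by cases on the level, each definitional). [cite: Balaban1988Convergent, (3.25) p.270 (bookkeeping)] -/
theorem slotsTOfRecord_eq_at (E : B12.RunParams → ℝ) (w : StepWeightsOfRecord F N ν τ.M) (ppSel : PpSelOfRecord F ν τ.M) :
    slotsTOfRecord F N ν τ E w ppSel = slotsTOfRecordAt F N ν τ (epsLetterOfRecord ν) E w ppSel := by
  funext p g k
  cases k <;> rfl

/-- **`ρ_k` AT LETTERS** — the density of record after `k` steps with every T-side threshold a letter: `Σ_s χ_k(s)|_{Θ_k}·slot|_Θ(s)`.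
[cite: Balaban1988Convergent, (2.18) p.257; Balaban1989LargeFieldI, (0.2) p.176] -/
def rhoOfRecordAt (Θ : ThresholdLetter) (E : B12.RunParams → ℝ) (w : StepWeightsOfRecord F N ν τ.M) (ppSel : PpSelOfRecord F ν τ.M)
    (p : B12.RunParams) (g : ℕ → ℝ) (k : ℕ) : Density (F.P p.K) k (SU N) :=
  densityOfReprAt F N ν τ.M Θ (slotsOfRecordAt F N ν τ Θ E w ppSel) p g k

/-- **BRIDGE**: `ρ_k` of record (`rhoOfRecord9`) IS `ρ_k` at the letter of record (definitional). [cite: Balaban1988Convergent, (2.18) p.257 (bookkeeping)] -/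
theorem rhoOfRecord9_eq_at (E : B12.RunParams → ℝ) (w : StepWeightsOfRecord F N ν τ.M) (ppSel : PpSelOfRecord F ν τ.M) :
    rhoOfRecord9 F N ν τ E w ppSel = rhoOfRecordAt F N ν τ (epsLetterOfRecord ν) E w ppSel := rfl

/-- **`𝐓ρ_k` AT LETTERS** — the T-stepped density at level k+1 with every T-side threshold a letter. [cite: Balaban1988Convergent, (3.1) p.264, (3.25) p.270] -/
def trhoOfRecordAt (Θ : ThresholdLetter) (E : B12.RunParams → ℝ) (w : StepWeightsOfRecord F N ν τ.M) (ppSel : PpSelOfRecord F ν τ.M)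
    (p : B12.RunParams) (g : ℕ → ℝ) (k : ℕ) : Density (F.P p.K) (k + 1) (SU N) :=
  densityOfReprAt F N ν τ.M Θ (slotsTOfRecordAt F N ν τ Θ E w ppSel) p g (k + 1)

/-- **BRIDGE**: `𝐓ρ_k` of record (`trhoOfRecord9`) IS `𝐓ρ_k` at the letter of record. [cite: Balaban1988Convergent, (3.25) p.270 (bookkeeping)] -/
theorem trhoOfRecord9_eq_at (E : B12.RunParams → ℝ) (w : StepWeightsOfRecord F N ν τ.M) (ppSel : PpSelOfRecord F ν τ.M) :
    trhoOfRecord9 F N ν τ E w ppSel = trhoOfRecordAt F N ν τ (epsLetterOfRecord ν) E w ppSel := by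
  funext p g k
  rw [trhoOfRecord9, trhoOfRecordAt, densityOfRepr_eq_at, slotsTOfRecord_eq_at]

/-- `ρ_0` at letters is `ρ₀` (`eval_zero`). [cite: Balaban1988Convergent, Thm 1 p.262, (2.18) p.257 (bookkeeping)] -/
theorem rhoOfRecordAt_zero (Θ : ThresholdLetter) (E : B12.RunParams → ℝ) (w : StepWeightsOfRecord F N ν τ.M) (ppSel : PpSelOfRecord F ν τ.M)
    (p : B12.RunParams) (g : ℕ → ℝ) :
    rhoOfRecordAt F N ν τ Θ E w ppSel p g 0 = rhoZeroOfRecord F N p.K (g 0) (E p) :=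
  densityOfReprAt_texpAOfRecordAt_zero F N ν τ.M Θ E w _ p g

end TowerAt

/-! ## §6  Under (H-U) ∧ (H-ζ): the letter objects are measurable (K0′-G3's (P2)∕(P3) rows at letters, same proofs) -/

section UnderHU

variable {F : T4Family} {N : ℕ} [NeZero N] {ν : Stage7Numerics} (hU : LocalBgMeasurable F N ν)
include hU

/-- `χ_k(Ω_k)|_ε` is measurable at EVERY letter, level and sequence under (H-U). [cite: Balaban1988Convergent, (2.17)–(2.18) p.257 (bookkeeping)] -/
theorem measurable_chiSeqOfRecordAt_of_localBg (M : ℕ) (g : ℕ → ℝ) (K k : ℕ) (ε : ℝ) (s : SeqOfRecord F ν M g K k) :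
    Measurable (chiSeqOfRecordAt F N ν M g K k ε s) := by
  unfold chiSeqOfRecordAt chi218 chi217
  exact Finset.measurable_prod _ fun c _ => (measurable_chiSmall_at _ _).comp (hU K k _)

/-- The (3.2) factor at a letter is measurable in `V′` under (H-U). [cite: Balaban1988Convergent, (3.2) p.265 (bookkeeping)] -/
theorem measurable_chiFactorAt_of_localBg (p : B12.RunParams) (g : ℕ → ℝ) (k : ℕ) (ε : ℝ) (c : Iχ F ν p g k) :
    Measurable (chiFactorAt F N ν p g k ε c) := by
  unfold chiFactorAt
  exact (measurable_chiSmall_at _ _).comp (hU p.K (k + 1) _)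

/-- `a|_ε(P)(V′)` is measurable under (H-U). [cite: Balaban1988Convergent, (3.2) p.265 (bookkeeping)] -/
theorem measurable_aWeightAt_of_localBg (M : ℕ) (p : B12.RunParams) (g : ℕ → ℝ) (k : ℕ) (ε : ℝ) (s : SeqOfRecord F ν M g p.K k)
    (Pl : Finset (Iχ F ν p g k)) : Measurable (aWeightAt F N ν M p g k ε s Pl) := by
  have hf : ∀ c : Iχ F ν p g k, Measurable fun V' : GaugeField (F.P p.K) (k + 1) (SU N) =>
      chiSmall ((sect3DataOfRecord F N ν M p g k s).plaqT c) (ε * (F.P p.K).eta (k + 1) ^ 2)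
        ((sect3DataOfRecord F N ν M p g k s).UkLoc c V') :=
    fun c => measurable_chiFactorAt_of_localBg hU p g k ε c
  unfold aWeightAt
  by_cases hP : Pl ⊆ cubes32 F ν M p g k s
  · simp only [if_pos hP]
    unfold chiNext chiNextc
    exact (Finset.measurable_prod _ fun c _ => hf c).mul (Finset.measurable_prod _ fun c _ => measurable_const.sub (hf c))
  · simp only [if_neg hP]; exact measurable_const

/-- `b|_{δ′}(P,Q)(U,V′)` is jointly measurable under (H-U), at every letter `δ′`. [cite: Balaban1988Convergent, (3.3)–(3.4) p.265 (bookkeeping)] -/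
theorem measurable_bWeightAt_of_localBg (M : ℕ) (p : B12.RunParams) (g : ℕ → ℝ) (k : ℕ) (δ' : ℝ) (s : SeqOfRecord F ν M g p.K k)
    (Pl Ql : Finset (Iχ F ν p g k)) :
    Measurable (fun z : GaugeField (F.P p.K) (k + 1) (SU N) × GaugeField (F.P p.K) k (SU N) => bWeightAt F N ν M p g k δ' s Pl Ql z.2 z.1) := by
  have hf : ∀ c : Iχ F ν p g k, MeasurableSet {z : GaugeField (F.P p.K) (k + 1) (SU N) × GaugeField (F.P p.K) k (SU N) |
      SmallApproxFluct (sect3DataOfRecord F N ν M p g k s) (avOfRecord F N p.K) δ' z.2 z.1 c} :=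
    fun c => measurableSet_smallApproxFluct_of_localBg hU M p g k s _ c
  unfold bWeightAt
  by_cases hQ : Ql ⊆ qcubes F ν M p g k s Pl
  · simp only [if_pos hQ]
    unfold chiPrime chiPrimec
    exact (Finset.measurable_prod _ fun c _ => Measurable.ite (hf c) measurable_const measurable_const).mul
      (Finset.measurable_prod _ fun c _ => Measurable.ite (hf c) measurable_const measurable_const)
  · simp only [if_neg hQ]; exact measurable_const

/-- **(O4) AT LETTERS UNDER (H-U) ∧ (H-ζ)**: the label weights `ω|_{ε,δ′} = a|_ε·b|_{δ′}·ζ` are jointly measurable for every residual `ζ` satisfying (H-ζ).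
[cite: Balaban1988Convergent, (3.2)–(3.5) p.265, (3.16) p.268 (bookkeeping)] -/
theorem measurable_ωOfRecordAt_of_localBg (M : ℕ) (p : B12.RunParams) (g : ℕ → ℝ) (k : ℕ) (ε δ' : ℝ) {ζ : ZetaOfRecord F N ν M}
    (hζ : ZetaMeasurable F N ζ) (s : SeqOfRecord F ν M g p.K k) (t : LbOfRecord F ν p g k) :
    Measurable (fun z : GaugeField (F.P p.K) (k + 1) (SU N) × GaugeField (F.P p.K) k (SU N) =>
      ωOfRecordAt F N ν M p g k ε δ' ζ s t z.2 z.1) := by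
  unfold ωOfRecordAt
  exact (((measurable_aWeightAt_of_localBg hU M p g k ε s t.1).comp measurable_fst).mul
    (measurable_bWeightAt_of_localBg hU M p g k δ' s t.1 t.2.1)).mul (hζ p g k s t.1 t.2.1 t.2.2)

/-- … hence the step weights at letters `wOfRecordAt Θ Δ ζ` are jointly measurable under (H-U) ∧ (H-ζ). [cite: Balaban1988Convergent, (3.2)–(3.3) p.265 (bookkeeping)] -/
theorem measurable_wOfRecordAt_of_localBg (M : ℕ) (Θ Δ : ThresholdLetter) {ζ : ZetaOfRecord F N ν M} (hζ : ZetaMeasurable F N ζ)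
    (p : B12.RunParams) (g : ℕ → ℝ) (k : ℕ) (s' : SeqOfRecord F ν M g p.K (k + 1)) :
    Measurable (fun z : GaugeField (F.P p.K) (k + 1) (SU N) × GaugeField (F.P p.K) k (SU N) =>
      wOfRecordAt F N ν M Θ Δ ζ p g k s' z.2 z.1) :=
  measurable_wOfRecordAt F N ν M Θ Δ ζ p g k (fun s t => measurable_ωOfRecordAt_of_localBg hU M p g k _ _ hζ s t) s'

end UnderHU

end Literature.MathematicalPhysics.QuantumFieldTheory.Balaban1983to89.Node00

end
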